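import Literature.NumberTheory.GaloisRepresentations.LocalGlobalCohomology
import Literature.NumberTheory.GaloisRepresentations.UnramifiedKummer
import Literature.NumberTheory.GaloisRepresentations.DiscreteCochains
import Literature.NumberTheory.Automorphic.AdicCompletionLocalField
import HarnessLib

/-!
# Bloch–Kato Selmer groups `H¹_f(K, W)` and Wiles's `H¹_Σ(K, W)`

Let `K` be a number field, `p` a prime, `T` a free module of finite rank over the ring of integers
`O` of a finite extension of `ℚ_p` with a continuous `Γ_K`-action, `V = T ⊗_O Frac O` and
`W = V/T` (a *discrete*, divisible Galois module; Rubin 1998 §1).  Bloch–Kato define, for every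
finite place `v` of `K`, subspaces `H¹_f(K_v, V) ⊆ H¹(K_v, V)` — the unramified classes
`ker (H¹(K_v, V) → H¹(K_v^{ur}, V))` if `v ∤ p`, and `ker (H¹(K_v, V) → H¹(K_v, B_crys ⊗ V))` if
`v ∣ p` [BlochKato1990, (3.7.1)–(3.7.2)] — then `H¹_f(K_v, W) := im (H¹_f(K_v, V) → H¹(K_v, W))`
[DiamondFlachGuo2004, §2.1; Rubin1998Durham, §1] and the **Bloch–Kato Selmer group**
`H¹_f(K, W) = {c ∈ H¹(K, W) | loc_v c ∈ H¹_f(K_v, W) for all finite v}` [BlochKato1990, Def. 5.1;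
DiamondFlachGuo2004, §2.1].  Wiles, Darmon–Diamond–Taylor and Diamond–Flach–Guo also use the larger
groups `H¹_Σ(K, W)`: no condition at the places of a finite set `Σ`, *all* unramified classes
`H¹_ur(K_v, W) = ker (H¹(K_v, W) → H¹(K_v^{ur}, W))` at the other `v ∤ p` (at `l ∣ N(ρ̄)` this is
Wiles's minimal condition, de Shalit 1997 §4.1), and a condition at `v ∣ p` (`f`, `ss`, …)
[DarmonDiamondTaylor1995, §2.3, §2.8; DiamondFlachGuo2004, §2.1; WashingtonCSS1997, §5–§7]; with
`Σ = ∅` this is the Selmer group "with minimal conditions", of order the congruence number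
[DarmonDiamondTaylor1995, Cor. 3.45].

Everything is built on the tree's Galois cohomology of discrete modules (`galoisCohomology`,
`DiscreteGaloisModule.SelmerStructure`, `SelmerStructure.selmerGroup`; files `GaloisCohomology`,
`LocalGlobalCohomology`), on `IsNonarchimedeanLocalField.maxUnramified F = F^{ur} = F(μ_{p'}) ⊆ F̄`
(file `UnramifiedKummer`; its fixer is the inertia group `absInertia F`,
`mem_absInertia_iff_forall_mem_maxUnramified`), the valuative structure of `K_v = v.adicCompletion K`
(`Automorphic.AdicCompletionLocalField`), and Mathlib's `continuousCohomology` for the non-discrete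
module `V`.

## Main definitions

* `ContinuousRep.cohomology τ n = Hⁿ_cont(G, V)` for a continuous `ℤ`-linear representation on a
  topological abelian group (`= galoisCohomology` on discrete Galois modules, definitionally);
  `ContinuousRep.cohomologyMap` (functoriality in the module), `ContinuousRep.cohomologyRes`
  (pull-back along `H →ₜ* G`), `ContinuousRep.toIntRep` (forget `A`-linearity).
* `GaloisRep.unramifiedSubgroup τ n = ker (Hⁿ(F, V) → Hⁿ(F^{ur}, V))` and, for discrete `W`,
  `DiscreteGaloisModule.unramifiedSubgroup ρ n ≤ galoisCohomology ρ n` (`H¹_ur(F, W)`).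
* `BlochKatoDatum F V W`: the data `π : V → W` (continuous, `Γ_F`-equivariant) presenting the discrete
  `W` as a quotient of the topological `V` (intended `W = V/T`); `projMap` (`π_*`), `finiteSubgroup`
  (`H¹_f(F, W) = π_* H¹_ur(F, V)`, the condition at `v ∤ p`), `imageSubgroup L = π_* L` (the condition
  at `v ∣ p` from a chosen `L = "H¹_f(F, V)"`), `toLocal`.
* `DiscreteGaloisModule.greenbergSubgroup ρ W⁺ = ker (H¹(F, W) → H¹(F^{ur}, W/W⁺))` (Greenberg's
  ordinary condition = DDT's `H¹_ss` = Washington's Choice 1 = de Shalit's `H¹_Se`) and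
  `DiscreteGaloisModule.strictSubgroup ρ W⁺ = ker (H¹(F, W) → H¹(F, W/W⁺))` (Wiles's strict
  condition = Washington's Choice 2), for a `Γ_F`-stable `W⁺ ≤ W`.
* Over a number field: `SelmerStructure.ofFinite` (conditions at finite places, none at infinite
  ones); `LocalConditionsAbove ρ p`, the type of local conditions at the places above `p` — **the
  parameter standing in for `B_crys`** — with `.relaxed` (`⊤`), `.strict` (`⊥`), `.greenberg`, and
  `BlochKatoDatum.LocalConditionsAbove.ofDatum` (`π_*` of chosen subgroups of `H¹(K_v, V)`);
  **`blochKatoSelmerStructure`, `blochKatoSelmerGroup D p L = H¹_f(K, W)`**;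
  **`DiscreteGaloisModule.sigmaSelmerStructure`, `sigmaSelmerGroup ρ p S L = H¹_S(K, W)`**.
* `SelmerStructure.HasCardLE 𝓛 B` / `HasCardEq 𝓛 B`: `H¹_𝓛(K, W)` is finite of order `≤ B` / `= B`,
  the printed form of the results (`#H¹_Σ(ℚ, ad⁰ρ_f ⊗ K/O) = #(O/η_Σ)` [DarmonDiamondTaylor1995,
  Cor. 3.45]); since `#M = q ^ length_O M` for a finite module `M` over a discrete valuation ring `O`
  with `q`-element residue field, `length_O H¹ ≤ v(η)` is `#H¹ ≤ #(O/η)`.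

## Design notes

* **The condition at `v ∣ p` is a parameter.**  The tree's period rings (`CrystallinePeriodRingData`,
  file `PAdicHodge`) carry no topology, so `H¹(K_v, B_crys ⊗ V)` cannot be formed; as the Langlands
  summit statement does with `ReciprocityData.pst`, the Selmer groups take the local conditions above
  `p` as a datum, and the file supplies the parameter-free conditions used in practice (relaxed,
  strict, Greenberg, strict-ordinary) and the transport `π_*` from `V`.  Rubin 1998, §1: "we just fix
  some choice of subspace `H¹_S(ℚ_{n,p}, V)`" (e.g. everything or `0`).
* **Infinite places.**  Bloch–Kato (Def. 5.1) and Darmon–Diamond–Taylor impose conditions at finite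
  places only, and so does `SelmerStructure.ofFinite`; Diamond–Flach–Guo put `H¹_f(ℚ_∞, V) = 0`.
  For odd `p` and `p`-primary `W` the two agree (`H¹(ℝ, W)` is killed by `2`); for `p = 2` they may
  differ (flagged, not resolved).
* **`H¹_f` versus `H¹_ur` at `v ∤ p`.**  `π_* H¹_ur(K_v, V)` is the maximal divisible subgroup of
  `H¹_ur(K_v, W)` and differs from it in general (Tamagawa factors) [DiamondFlachGuo2004, §2.1]; the
  two are kept apart (`finiteSubgroup` vs `unramifiedSubgroup`); `finiteSubgroup_le_unramifiedSubgroup`.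
* **No `O`-module structure** is put on `H¹(K, W)` (`galoisCohomology` is `ℤ`-linear); `length_O`
  statements go through `HasCardLE`/`HasCardEq`, which is the printed form.
* **Local fields.**  The local definitions only use a valuative structure `[ValuativeRel F]` (through
  `𝒪[F]` in `maxUnramified F`); the intended `F` is a non-archimedean local field (`K_v`), where
  `maxUnramified F` is the maximal unramified extension.  Finite places are handled through
  `GaloisRep.toLocal v ρ` on `v.adicCompletion K`, definitionally `ρ.toLocal (Sum.inr v)`.
* **Junk.**  `BlochKatoDatum` does not record that `π` is surjective with kernel a lattice; in
  `sigmaSelmerStructure` the places above `p` take the parameter even if they lie in `S`.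

## References

* [BlochKato1990] §3 (3.7.1)–(3.7.3), remark after (3.7.4); Def. 5.1.
* [Rubin1998Durham] §1.  (See also K. Rubin, *Euler Systems* (2000), §1.3 [Rubin2000].)
* [DiamondFlachGuo2004] §2.1, Lemma 2.1.  [DarmonDiamondTaylor1995] §2.3 (Thm. 2.19), §2.5, §2.8,
  Cor. 3.45.  [WashingtonCSS1997] §5–§7.  [deShalit1997] §4.1.  [Wiles1995Annals] Ch. 1 §1.
  [GreenbergLNM1716] §2.
-/

noncomputable section

open scoped NumberField ContRepresentation
open Field IsDedekindDomain CategoryTheory NumberField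

namespace Literature.NumberTheory.GaloisRepresentations

universe u

/-! ### Continuous cohomology with not necessarily discrete coefficients -/

namespace ContinuousRep

section IntRep

variable {G : Type*} [Group G] [TopologicalSpace G]

/-- Forget the `A`-linearity of a continuous representation: the underlying continuous `ℤ`-linear
representation on the topological abelian group `M` (`LinearMap.toAddMonoidHom`,
`AddMonoidHom.toIntLinearMap`).  Continuous cohomology only sees this. [folklore] -/
def toIntRep {A : Type*} [CommRing A] [TopologicalSpace A] {M : Type*} [AddCommGroup M]
    [Module A M] [TopologicalSpace M] (ρ : ContinuousRep G A M) : ContinuousRep G ℤ M where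
  toRepresentation :=
    { toFun := fun g => (ρ g).toAddMonoidHom.toIntLinearMap
      map_one' := by ext; simp
      map_mul' := fun g h => by ext; simp }
  continuous_smul := ρ.continuous_smul

/-- Unfolding lemma for `toIntRep`. [folklore] -/
@[simp] lemma toIntRep_apply_apply {A : Type*} [CommRing A] [TopologicalSpace A] {M : Type*}
    [AddCommGroup M] [Module A M] [TopologicalSpace M] (ρ : ContinuousRep G A M) (g : G) (m : M) :
    ρ.toIntRep g m = ρ g m := rfl

end IntRep

section General

variable {G : Type u} [Group G] [TopologicalSpace G] [IsTopologicalGroup G]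
  {V : Type u} [AddCommGroup V] [TopologicalSpace V] [IsTopologicalAddGroup V]
  {W : Type u} [AddCommGroup W] [TopologicalSpace W] [IsTopologicalAddGroup W]

/-- The **continuous cohomology group** `Hⁿ_cont(G, V)` of a continuous `ℤ`-linear representation
of a topological group `G` on a topological abelian group `V` (not necessarily discrete, e.g. a
`ℚ_p`-vector space with its `p`-adic topology): the carrier of Mathlib's
`continuousCohomology n τ.toTopRep` (homogeneous continuous cochains).  For a discrete Galois
module this is the tree's `galoisCohomology` (`galoisCohomology_eq_cohomology`).
Ref: J. Tate, *Relations between K₂ and Galois cohomology*, Invent. Math. 36 (1976), §2;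
Mathlib `RepresentationTheory/Homological/ContCohomology/Basic.lean`. [folklore] -/
def cohomology (τ : ContinuousRep G ℤ V) (n : ℕ) : Type u :=
  (continuousCohomology n τ.toTopRep : TopModuleCat ℤ)

/-- `Hⁿ_cont(G, V)` is an abelian group (structure of Mathlib's `TopModuleCat ℤ` object). [folklore] -/
instance cohomology.instAddCommGroup (τ : ContinuousRep G ℤ V) (n : ℕ) :
    AddCommGroup (τ.cohomology n) :=
  inferInstanceAs <| AddCommGroup (continuousCohomology n τ.toTopRep : TopModuleCat ℤ)

/-- Functoriality of `Hⁿ_cont(G, –)` in the module: the map `Hⁿ(G, V) →+ Hⁿ(G, W)` induced by a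
continuous `G`-equivariant additive map `π : V → W` (Mathlib `ContinuousCohomology.map` along
`ContinuousMonoidHom.id G` and the morphism of `TopRep ℤ G` defined by `π`).  Used for
`V ↠ W = V/T` and for `W ↠ W/W⁺`.
Ref: Serre, *Galois Cohomology* (1997), Ch. I §2.2. [folklore] -/
def cohomologyMap (τ : ContinuousRep G ℤ V) (τ' : ContinuousRep G ℤ W) (π : V →+ W)
    (hπ : Continuous π) (h : ∀ (g : G) (x : V), π (τ g x) = τ' g (π x)) (n : ℕ) :
    τ.cohomology n →+ τ'.cohomology n :=
  (ContinuousCohomology.map (ContinuousMonoidHom.id G) (X := τ.toTopRep) (Y := τ'.toTopRep)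
    (TopRep.ofHom ⟨⟨π.toIntLinearMap, hπ⟩, fun g => ContinuousLinearMap.ext fun x => h g x⟩)
    n).hom.toLinearMap.toAddMonoidHom

/-- Functoriality of `Hⁿ_cont(–, V)` in the group: pull-back `Hⁿ(G, V) →+ Hⁿ(H, V)` along a
continuous homomorphism `φ : H →ₜ* G` (`H` acting through `φ`, `ContinuousRep.restrict`); Mathlib
`ContinuousCohomology.map φ (𝟙 _)`.  On discrete Galois modules this is `galoisCohomology.pullback`.
Ref: Serre, *Galois Cohomology* (1997), Ch. I §2.4. [folklore] -/
def cohomologyRes {H : Type u} [Group H] [TopologicalSpace H] [IsTopologicalGroup H]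
    (τ : ContinuousRep G ℤ V) (φ : H →ₜ* G) (n : ℕ) :
    τ.cohomology n →+ (τ.restrict φ).cohomology n :=
  (ContinuousCohomology.map φ (X := τ.toTopRep) (Y := (τ.restrict φ).toTopRep)
    (TopRep.ofHom ⟨ContinuousLinearMap.id ℤ V, fun _ => rfl⟩) n).hom.toLinearMap.toAddMonoidHom

end General

end ContinuousRep

section DiscreteCompat

variable {F : Type u} [Field F] {W : Type u} [AddCommGroup W] [TopologicalSpace W]
  [DiscreteTopology W]

/-- For a discrete Galois module, `galoisCohomology ρ n` *is* `ContinuousRep.cohomology ρ n`. [folklore] -/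
theorem galoisCohomology_eq_cohomology (ρ : DiscreteGaloisModule F W) (n : ℕ) :
    galoisCohomology ρ n = ContinuousRep.cohomology ρ n := rfl

/-- … and restriction to an extension field is `ContinuousRep.cohomologyRes` along
`absGaloisRestrict`. [folklore] -/
theorem galoisCohomology_res_eq_cohomologyRes (ρ : DiscreteGaloisModule F W) (L : Type u)
    [Field L] [Algebra F L] (n : ℕ) :
    galoisCohomology.res ρ L n = ContinuousRep.cohomologyRes ρ (absGaloisRestrict F L) n := rfl

end DiscreteCompat

/-! ### Unramified classes, Greenberg's condition, the strict condition (over a valued field) -/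

section LocalField

variable {F : Type u} [Field F] [ValuativeRel F]
  {V : Type u} [AddCommGroup V] [TopologicalSpace V] [IsTopologicalAddGroup V]
  {W : Type u} [AddCommGroup W] [TopologicalSpace W] [DiscreteTopology W]

/-- The **unramified classes** `Hⁿ_ur(F, V) = ker (Hⁿ(F, V) → Hⁿ(F^{ur}, V))` of a topological
`Γ_F`-module `V` over a valued field `F` (intended: a non-archimedean local field): restriction to
`F^{ur} = IsNonarchimedeanLocalField.maxUnramified F = F(μ_{p'}) ⊆ F̄`, the maximal unramified
extension, whose absolute Galois group maps onto the inertia group `I_F = absInertia F`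
(`mem_absInertia_iff_forall_mem_maxUnramified`), so that in degree `1` this is
`ker (H¹(F, V) → H¹(I_F, V)) = H¹(F^{ur}/F, V^{I_F})`.  Bloch–Kato's `H¹_f(K, V)` for `l ≠ p`.
[cite: BlochKato1990, (3.7.1)] -/
def GaloisRep.unramifiedSubgroup (τ : GaloisRep F ℤ V) (n : ℕ) : AddSubgroup (τ.cohomology n) :=
  (τ.cohomologyRes (absGaloisRestrict F (IsNonarchimedeanLocalField.maxUnramified F)) n).ker

/-- Membership in `Hⁿ_ur(F, V)`: the restriction to `Γ_{F^{ur}}` vanishes. [folklore] -/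
lemma GaloisRep.mem_unramifiedSubgroup_iff (τ : GaloisRep F ℤ V) (n : ℕ) (c : τ.cohomology n) :
    c ∈ τ.unramifiedSubgroup n ↔
      τ.cohomologyRes (absGaloisRestrict F (IsNonarchimedeanLocalField.maxUnramified F)) n c = 0 :=
  Iff.rfl

namespace DiscreteGaloisModule

/-- The **unramified subgroup** `Hⁿ_ur(F, W) = ker (Hⁿ(F, W) → Hⁿ(F^{ur}, W))` of a *discrete*
Galois module over a valued field `F` (intended: `F = K_v`), inside the tree's `galoisCohomology ρ n`
(`galoisCohomology.res` to `F^{ur} = maxUnramified F`); for `n = 1`,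
`H¹_ur(F, W) = H¹(F^{ur}/F, W^{I_F})`, the local condition "unramified" — Wiles's minimal
condition `H¹(G_l/I_l, W^{I_l})` at `l ∣ N(ρ̄)`.
[cite: DiamondFlachGuo2004, §2.1] -/
def unramifiedSubgroup (ρ : DiscreteGaloisModule F W) (n : ℕ) : AddSubgroup (galoisCohomology ρ n) :=
  (galoisCohomology.res ρ (IsNonarchimedeanLocalField.maxUnramified F) n).ker

/-- Membership in `Hⁿ_ur(F, W)`. [folklore] -/
lemma mem_unramifiedSubgroup_iff (ρ : DiscreteGaloisModule F W) (n : ℕ) (c : galoisCohomology ρ n) :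
    c ∈ ρ.unramifiedSubgroup n ↔
      galoisCohomology.res ρ (IsNonarchimedeanLocalField.maxUnramified F) n c = 0 :=
  Iff.rfl

/-- The discrete-module unramified subgroup is the general one (definitionally). [folklore] -/
theorem unramifiedSubgroup_eq (ρ : DiscreteGaloisModule F W) (n : ℕ) :
    ρ.unramifiedSubgroup n = GaloisRep.unramifiedSubgroup ρ n := rfl

end DiscreteGaloisModule

end LocalField

section Quotient

variable {F : Type u} [Field F] {W : Type u} [AddCommGroup W] [TopologicalSpace W]
  [DiscreteTopology W]

namespace DiscreteGaloisModule

/-- The map `Hⁿ(F, W) →+ Hⁿ(F, W/W⁺)` induced by the quotient map by a `Γ_F`-stable subgroup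
`W⁺ ≤ W` (`ContinuousRep.quotient`, a discrete Galois module). [folklore] -/
def quotientMap (ρ : DiscreteGaloisModule F W) (Wp : Submodule ℤ W)
    (h : ∀ σ : absoluteGaloisGroup F, Wp ≤ Wp.comap (ρ σ)) (n : ℕ) :
    galoisCohomology ρ n →+ galoisCohomology (ρ.quotient Wp h) n :=
  ContinuousRep.cohomologyMap ρ (ρ.quotient Wp h) Wp.mkQ.toAddMonoidHom
    continuous_of_discreteTopology (fun _ _ => rfl) n

/-- The **strict (ordinary) local condition** `H¹_str(F, W) = ker (H¹(F, W) → H¹(F, W/W⁺))` for a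
`Γ_F`-stable `W⁺ ≤ W` (Wiles's "strict" condition; Washington's "Choice 2", used for multiplicative
reduction at `p`).  [cite: WashingtonCSS1997, §7 Choice 2] -/
def strictSubgroup (ρ : DiscreteGaloisModule F W) (Wp : Submodule ℤ W)
    (h : ∀ σ : absoluteGaloisGroup F, Wp ≤ Wp.comap (ρ σ)) : AddSubgroup (galoisCohomology ρ 1) :=
  (ρ.quotientMap Wp h 1).ker

/-- Membership in the strict subgroup. [folklore] -/
lemma mem_strictSubgroup_iff (ρ : DiscreteGaloisModule F W) (Wp : Submodule ℤ W)
    (h : ∀ σ : absoluteGaloisGroup F, Wp ≤ Wp.comap (ρ σ)) (c : galoisCohomology ρ 1) :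
    c ∈ ρ.strictSubgroup Wp h ↔ ρ.quotientMap Wp h 1 c = 0 :=
  Iff.rfl

variable [ValuativeRel F]

/-- **Greenberg's (ordinary) local condition** for a `Γ_F`-stable subgroup `W⁺ ≤ W`:
`H¹_Gr(F, W) = ker (H¹(F, W) → H¹(F^{ur}, W/W⁺)) = ker (H¹(F, W) → H¹(I_F, W/W⁺))`.
This is Darmon–Diamond–Taylor's `H¹_ss` for an ordinary `ρ` (with `W⁺ = ad^{(-1)}ρ`), Washington's
"Choice 1" and de Shalit's `H¹_Se`.
[cite: DarmonDiamondTaylor1995, §2.5 (p. 67)] -/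
def greenbergSubgroup (ρ : DiscreteGaloisModule F W) (Wp : Submodule ℤ W)
    (h : ∀ σ : absoluteGaloisGroup F, Wp ≤ Wp.comap (ρ σ)) : AddSubgroup (galoisCohomology ρ 1) :=
  (unramifiedSubgroup (ρ.quotient Wp h) 1).comap (ρ.quotientMap Wp h 1)

/-- Membership in Greenberg's subgroup: the image in `H¹(F, W/W⁺)` is unramified. [folklore] -/
lemma mem_greenbergSubgroup_iff (ρ : DiscreteGaloisModule F W) (Wp : Submodule ℤ W)
    (h : ∀ σ : absoluteGaloisGroup F, Wp ≤ Wp.comap (ρ σ)) (c : galoisCohomology ρ 1) :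
    c ∈ ρ.greenbergSubgroup Wp h ↔
      ρ.quotientMap Wp h 1 c ∈ unramifiedSubgroup (ρ.quotient Wp h) 1 :=
  Iff.rfl

/-- `H¹_str ≤ H¹_Gr`: a class dying in `H¹(F, W/W⁺)` dies in `H¹(F^{ur}, W/W⁺)`.
[cite: WashingtonCSS1997, §7] -/
theorem strictSubgroup_le_greenbergSubgroup (ρ : DiscreteGaloisModule F W) (Wp : Submodule ℤ W)
    (h : ∀ σ : absoluteGaloisGroup F, Wp ≤ Wp.comap (ρ σ)) :
    ρ.strictSubgroup Wp h ≤ ρ.greenbergSubgroup Wp h := fun c hc => by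
  rw [mem_greenbergSubgroup_iff, (mem_strictSubgroup_iff ρ Wp h c).1 hc]
  exact zero_mem _

end DiscreteGaloisModule

end Quotient

/-! ### The Bloch–Kato datum `π : V → W` and the local conditions `H¹_f(F, W)` -/

/-- A **Bloch–Kato datum** over the field `F`: a topological `Γ_F`-module `V` (a continuous
`ℤ`-linear representation `repV`, e.g. `T ⊗ ℚ_p` with its `p`-adic topology, `A`-linearity
forgotten via `ContinuousRep.toIntRep`), a discrete Galois module `W` (`repW`) and a continuous
`Γ_F`-equivariant additive map `proj : V → W`.  Intended instance: `W = V/T` for a `Γ_F`-stable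
lattice `T ⊆ V` and `proj` the quotient map ("`0 → T → V → W → 0`", Rubin); nothing else about
`proj` is recorded (design notes).
[cite: Rubin1998Durham, §1] -/
structure BlochKatoDatum (F : Type u) [Field F] (V W : Type u) [AddCommGroup V] [TopologicalSpace V]
    [IsTopologicalAddGroup V] [AddCommGroup W] [TopologicalSpace W] [DiscreteTopology W] :
    Type u where
  /-- The topological `Γ_F`-module `V`. -/
  repV : GaloisRep F ℤ V
  /-- The discrete `Γ_F`-module `W`. -/
  repW : DiscreteGaloisModule F W
  /-- The map `π : V → W` (intended: `V ↠ V/T`). -/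
  proj : V →+ W
  /-- `π` is continuous. -/
  continuous_proj : Continuous proj
  /-- `π` is `Γ_F`-equivariant. -/
  proj_apply : ∀ (σ : absoluteGaloisGroup F) (x : V), proj (repV σ x) = repW σ (proj x)

namespace BlochKatoDatum

section AnyField

variable {F : Type u} [Field F] {V W : Type u} [AddCommGroup V] [TopologicalSpace V]
  [IsTopologicalAddGroup V] [AddCommGroup W] [TopologicalSpace W] [DiscreteTopology W]

/-- Restriction of a Bloch–Kato datum to an extension field `L` of `F` (both representations
restricted along `absGaloisRestrict F L`, `GaloisRep.restrictField`). [folklore] -/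
def restrictField (D : BlochKatoDatum F V W) (L : Type u) [Field L] [Algebra F L] :
    BlochKatoDatum L V W where
  repV := D.repV.restrictField L
  repW := D.repW.restrictField L
  proj := D.proj
  continuous_proj := D.continuous_proj
  proj_apply σ x := D.proj_apply (absGaloisRestrict F L σ) x

/-- The map **`π_* : Hⁿ(F, V) →+ Hⁿ(F, W)`** induced by `π : V → W`
(`ContinuousRep.cohomologyMap`). [cite: DiamondFlachGuo2004, §2.1] -/
def projMap (D : BlochKatoDatum F V W) (n : ℕ) : D.repV.cohomology n →+ galoisCohomology D.repW n :=
  ContinuousRep.cohomologyMap D.repV D.repW D.proj D.continuous_proj D.proj_apply n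

/-- The image `π_* L ⊆ H¹(F, W)` of a chosen subgroup `L ⊆ H¹(F, V)` — the recipe
"`H¹_f(F, W) := im (H¹_f(F, V) → H¹(F, W))`" applied to `L` (at `v ∣ p` the intended `L` is
`ker (H¹(F, V) → H¹(F, B_crys ⊗ V))`, supplied as a parameter).
[cite: DiamondFlachGuo2004, §2.1] -/
def imageSubgroup (D : BlochKatoDatum F V W) (L : AddSubgroup (D.repV.cohomology 1)) :
    AddSubgroup (galoisCohomology D.repW 1) :=
  L.map (D.projMap 1)

/-- Membership in `π_* L`. [folklore] -/
lemma mem_imageSubgroup_iff (D : BlochKatoDatum F V W) (L : AddSubgroup (D.repV.cohomology 1))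
    (c : galoisCohomology D.repW 1) :
    c ∈ D.imageSubgroup L ↔ ∃ x ∈ L, D.projMap 1 x = c :=
  AddSubgroup.mem_map

/-- Naturality of restriction: restricting to an extension `L` after `π_*` is `π_*` (for the
restricted datum) after restricting (both composites are Mathlib's `ContinuousCohomology.map`
along `Γ_L → Γ_F` and `π`, by `ContinuousCohomology.map_comp`). [folklore] -/
theorem res_projMap_apply (D : BlochKatoDatum F V W) (L : Type u) [Field L] [Algebra F L] (n : ℕ)
    (x : D.repV.cohomology n) :
    galoisCohomology.res D.repW L n (D.projMap n x) =
      (D.restrictField L).projMap n (D.repV.cohomologyRes (absGaloisRestrict F L) n x) := by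
  have h1 := ContinuousCohomology.map_comp (ContinuousMonoidHom.id (absoluteGaloisGroup F))
    (absGaloisRestrict F L) (X := D.repV.toTopRep) (Y := D.repW.toTopRep)
    (Z := DiscreteGaloisModule.toTopRep (D.repW.restrictField L))
    (TopRep.ofHom ⟨⟨D.proj.toIntLinearMap, D.continuous_proj⟩,
      fun g => ContinuousLinearMap.ext fun v => D.proj_apply g v⟩)
    (TopRep.ofHom ⟨ContinuousLinearMap.id ℤ W, fun _ => rfl⟩) n
  have h2 := ContinuousCohomology.map_comp (absGaloisRestrict F L)
    (ContinuousMonoidHom.id (absoluteGaloisGroup L))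
    (X := D.repV.toTopRep) (Y := (D.repV.restrictField L).toTopRep)
    (Z := DiscreteGaloisModule.toTopRep (D.repW.restrictField L))
    (TopRep.ofHom ⟨ContinuousLinearMap.id ℤ V, fun _ => rfl⟩)
    (TopRep.ofHom ⟨⟨D.proj.toIntLinearMap, D.continuous_proj⟩,
      fun g => ContinuousLinearMap.ext fun v => D.proj_apply (absGaloisRestrict F L g) v⟩) n
  have e : ∀ T T' : continuousCohomology n D.repV.toTopRep ⟶
      continuousCohomology n (DiscreteGaloisModule.toTopRep (D.repW.restrictField L)),
      T = T' → TopModuleCat.Hom.hom T x = TopModuleCat.Hom.hom T' x := fun T T' h => h ▸ rfl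
  exact e _ _ (h1.symm.trans h2)

end AnyField

section Valued

variable {F : Type u} [Field F] [ValuativeRel F] {V W : Type u} [AddCommGroup V] [TopologicalSpace V]
  [IsTopologicalAddGroup V] [AddCommGroup W] [TopologicalSpace W] [DiscreteTopology W]

/-- The **Bloch–Kato finite subgroup at a place `v ∤ p`**: `H¹_f(F, W) = π_* H¹_f(F, V)` with
`H¹_f(F, V) = H¹_ur(F, V) = ker (H¹(F, V) → H¹(F^{ur}, V))`.  It is the maximal divisible subgroup
of `H¹_ur(F, W)` (Diamond–Flach–Guo), in particular contained in it
(`finiteSubgroup_le_unramifiedSubgroup`).  [cite: BlochKato1990, (3.7.1)] -/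
def finiteSubgroup (D : BlochKatoDatum F V W) : AddSubgroup (galoisCohomology D.repW 1) :=
  D.imageSubgroup (D.repV.unramifiedSubgroup 1)

/-- Membership in `H¹_f(F, W)` (`v ∤ p`): the class is `π_*` of an unramified class of `V`. [folklore] -/
lemma mem_finiteSubgroup_iff (D : BlochKatoDatum F V W) (c : galoisCohomology D.repW 1) :
    c ∈ D.finiteSubgroup ↔ ∃ x ∈ D.repV.unramifiedSubgroup 1, D.projMap 1 x = c :=
  AddSubgroup.mem_map

/-- **`H¹_f(F, W) ≤ H¹_ur(F, W)`**: the Bloch–Kato condition at `v ∤ p` implies unramifiedness (the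
image of an unramified class of `V` is an unramified class of `W`).
[cite: DiamondFlachGuo2004, §2.1] -/
theorem finiteSubgroup_le_unramifiedSubgroup (D : BlochKatoDatum F V W) :
    D.finiteSubgroup ≤ D.repW.unramifiedSubgroup 1 := by
  rintro c ⟨x, hx, rfl⟩
  have hx' : D.repV.cohomologyRes
      (absGaloisRestrict F (IsNonarchimedeanLocalField.maxUnramified F)) 1 x = 0 := hx
  rw [DiscreteGaloisModule.mem_unramifiedSubgroup_iff, res_projMap_apply, hx']
  exact map_zero _

end Valued

end BlochKatoDatum

/-! ### Selmer structures and Selmer groups over a number field -/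

section NumberField

variable {K : Type u} [Field K] [NumberField K] {V W : Type u} [AddCommGroup V] [TopologicalSpace V]
  [IsTopologicalAddGroup V] [AddCommGroup W] [TopologicalSpace W] [DiscreteTopology W]

namespace DiscreteGaloisModule

/-- A Selmer structure **from local conditions at the finite places**: `L v ≤ H¹(K_v, W)` at the
finite place `v` (`K_v = v.adicCompletion K`, local module `GaloisRep.toLocal v ρ`, definitionally
`ρ.toLocal (Sum.inr v)`), and no condition (`⊤`) at the infinite places, as in Bloch–Kato's
Definition 5.1 and Darmon–Diamond–Taylor's `H¹_L(F, M)` over a number field.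
[cite: DarmonDiamondTaylor1995, §2.3 (Thm. 2.19)] -/
def SelmerStructure.ofFinite (ρ : DiscreteGaloisModule K W)
    (L : ∀ v : HeightOneSpectrum (𝓞 K), AddSubgroup (galoisCohomology (GaloisRep.toLocal v ρ) 1)) :
    SelmerStructure ρ
  | Sum.inl _ => ⊤
  | Sum.inr v => L v

/-- `ofFinite` imposes nothing at an infinite place. [folklore] -/
@[simp] lemma SelmerStructure.ofFinite_inl (ρ : DiscreteGaloisModule K W)
    (L : ∀ v : HeightOneSpectrum (𝓞 K), AddSubgroup (galoisCohomology (GaloisRep.toLocal v ρ) 1))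
    (w : InfinitePlace K) : SelmerStructure.ofFinite ρ L (Sum.inl w) = ⊤ := rfl

/-- `ofFinite` at a finite place is the prescribed condition. [folklore] -/
@[simp] lemma SelmerStructure.ofFinite_inr (ρ : DiscreteGaloisModule K W)
    (L : ∀ v : HeightOneSpectrum (𝓞 K), AddSubgroup (galoisCohomology (GaloisRep.toLocal v ρ) 1))
    (v : HeightOneSpectrum (𝓞 K)) : SelmerStructure.ofFinite ρ L (Sum.inr v) = L v := rfl

/-- Membership in the Selmer group of `ofFinite ρ L`: only the finite places matter. [folklore] -/
theorem SelmerStructure.mem_selmerGroup_ofFinite_iff (ρ : DiscreteGaloisModule K W)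
    (L : ∀ v : HeightOneSpectrum (𝓞 K), AddSubgroup (galoisCohomology (GaloisRep.toLocal v ρ) 1))
    (c : galoisCohomology ρ 1) :
    c ∈ (SelmerStructure.ofFinite ρ L).selmerGroup ↔
      ∀ v : HeightOneSpectrum (𝓞 K), galoisCohomology.localization ρ (Sum.inr v) 1 c ∈ L v := by
  rw [SelmerStructure.mem_selmerGroup_iff]
  refine ⟨fun h v => h (Sum.inr v), fun h v => ?_⟩
  cases v with
  | inl w => exact AddSubgroup.mem_top _
  | inr v => exact h v

/-- **`#H¹_𝓛(K, W) ≤ B`**: the Selmer group of `𝓛` is finite of order at most `B` — the printed form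
of Selmer-group bounds (`#H¹_Σ(ℚ, ad⁰ρ_f ⊗ K/O) ≤ #(O/η_Σ)`); for a finite `O`-module `M` over a
discrete valuation ring `O` with residue field of `q` elements `#M = q ^ length_O M`, so this
expresses `length_O H¹_𝓛 ≤ length_O (O/η)` when `B = #(O/η)`.
[cite: DarmonDiamondTaylor1995, (3.5.2)] -/
def SelmerStructure.HasCardLE {ρ : DiscreteGaloisModule K W} (𝓛 : SelmerStructure ρ) (B : ℕ) :
    Prop :=
  Finite 𝓛.selmerGroup ∧ Nat.card 𝓛.selmerGroup ≤ B

/-- **`#H¹_𝓛(K, W) = B`** (finite, of order exactly `B`), as in `#H¹_Σ(ℚ, ad⁰ρ_f ⊗ K/O) = #(O/η_Σ)`.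
[cite: DarmonDiamondTaylor1995, Cor. 3.45] -/
def SelmerStructure.HasCardEq {ρ : DiscreteGaloisModule K W} (𝓛 : SelmerStructure ρ) (B : ℕ) :
    Prop :=
  Finite 𝓛.selmerGroup ∧ Nat.card 𝓛.selmerGroup = B

/-- `HasCardEq B` implies `HasCardLE B`. [folklore] -/
theorem SelmerStructure.HasCardEq.hasCardLE {ρ : DiscreteGaloisModule K W} {𝓛 : SelmerStructure ρ}
    {B : ℕ} (h : 𝓛.HasCardEq B) : 𝓛.HasCardLE B :=
  ⟨h.1, h.2.le⟩

variable (p : ℕ)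

/-- **Local conditions at the places above `p`** for the discrete module `W`: a subgroup of
`H¹(K_v, W)` for every finite place `v` with `p ∈ v`.  This is the parameter standing in for the
`B_crys`-condition (design notes); constructors `relaxed`, `strict`, `greenberg`,
`BlochKatoDatum.LocalConditionsAbove.ofDatum`. [cite: Rubin1998Durham, §1] -/
abbrev LocalConditionsAbove (ρ : DiscreteGaloisModule K W) : Type u :=
  ∀ v : HeightOneSpectrum (𝓞 K), ((p : ℕ) : 𝓞 K) ∈ v.asIdeal →
    AddSubgroup (galoisCohomology (GaloisRep.toLocal v ρ) 1)

namespace LocalConditionsAbove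

/-- The **relaxed** condition above `p`: no condition, `L_v = H¹(K_v, W)` ("we simply took `L_q` to
be the whole `H¹`"; `L_{Σ,p} = H¹(G_p, ad⁰ρ)` for `p ∈ Σ`).
[cite: DarmonDiamondTaylor1995, §2.8] -/
def relaxed (ρ : DiscreteGaloisModule K W) : ρ.LocalConditionsAbove p := fun _ _ => ⊤

/-- The **strict** condition above `p`: `L_v = 0` (Rubin: "or `H¹_S(ℚ_{n,p}, V) = 0`").
[cite: Rubin1998Durham, §1] -/
def strict (ρ : DiscreteGaloisModule K W) : ρ.LocalConditionsAbove p := fun _ _ => ⊥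

/-- The **Greenberg (ordinary) conditions** above `p` from a family of `Γ_{K_v}`-stable subgroups
`W⁺_v ≤ W`, `v ∣ p`: `L_v = ker (H¹(K_v, W) → H¹(K_v^{ur}, W/W⁺_v))` (`greenbergSubgroup`).
[cite: DarmonDiamondTaylor1995, §2.5 (p. 67)] -/
def greenberg (ρ : DiscreteGaloisModule K W)
    (Wp : ∀ v : HeightOneSpectrum (𝓞 K), ((p : ℕ) : 𝓞 K) ∈ v.asIdeal → Submodule ℤ W)
    (h : ∀ (v : HeightOneSpectrum (𝓞 K)) (hv : ((p : ℕ) : 𝓞 K) ∈ v.asIdeal)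
      (σ : absoluteGaloisGroup (v.adicCompletion K)),
      Wp v hv ≤ (Wp v hv).comap (GaloisRep.toLocal v ρ σ)) :
    ρ.LocalConditionsAbove p :=
  fun v hv => greenbergSubgroup (GaloisRep.toLocal v ρ) (Wp v hv) (h v hv)

end LocalConditionsAbove

/-- The **`Σ`-Selmer structure** of a discrete module `W` (Wiles, Darmon–Diamond–Taylor,
Diamond–Flach–Guo `H¹_Σ`; here `Σ = S`, a set of finite places): the given condition `L v` at the
places above `p`; no condition at the other places of `S` and at the infinite places; the unramified
classes `H¹_ur(K_v, W)` at the remaining finite places (at ramified `v` this is Wiles's minimal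
condition).  `S = ∅` gives the "minimal" conditions.  [cite: DiamondFlachGuo2004, §2.1] -/
def sigmaSelmerStructure (ρ : DiscreteGaloisModule K W) (S : Set (HeightOneSpectrum (𝓞 K)))
    (L : ρ.LocalConditionsAbove p) : SelmerStructure ρ :=
  SelmerStructure.ofFinite ρ fun v =>
    haveI := Classical.propDecidable
    if hv : ((p : ℕ) : 𝓞 K) ∈ v.asIdeal then L v hv
    else if v ∈ S then ⊤ else unramifiedSubgroup (GaloisRep.toLocal v ρ) 1

/-- **`H¹_Σ(K, W)`**, the Selmer group of `sigmaSelmerStructure ρ p S L` (with `S = ∅` and `L` the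
finite condition: the Selmer group with minimal conditions, of order the congruence number,
`#H¹_∅(ℚ, ad⁰ρ_f ⊗ K/O) = #(O/η_∅)`).  [cite: DarmonDiamondTaylor1995, §2.8 and Cor. 3.45] -/
def sigmaSelmerGroup (ρ : DiscreteGaloisModule K W) (S : Set (HeightOneSpectrum (𝓞 K)))
    (L : ρ.LocalConditionsAbove p) : AddSubgroup (galoisCohomology ρ 1) :=
  (ρ.sigmaSelmerStructure p S L).selmerGroup

variable {p}

/-- The `Σ`-structure above `p` is the parameter. [folklore] -/
theorem sigmaSelmerStructure_inr_of_mem (ρ : DiscreteGaloisModule K W)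
    (S : Set (HeightOneSpectrum (𝓞 K))) (L : ρ.LocalConditionsAbove p) {v : HeightOneSpectrum (𝓞 K)}
    (hv : ((p : ℕ) : 𝓞 K) ∈ v.asIdeal) : ρ.sigmaSelmerStructure p S L (Sum.inr v) = L v hv := by
  simp only [sigmaSelmerStructure, SelmerStructure.ofFinite_inr, dif_pos hv]

/-- The `Σ`-structure at `v ∈ S`, `v ∤ p`, is everything. [folklore] -/
theorem sigmaSelmerStructure_inr_of_mem_S (ρ : DiscreteGaloisModule K W)
    (S : Set (HeightOneSpectrum (𝓞 K))) (L : ρ.LocalConditionsAbove p) {v : HeightOneSpectrum (𝓞 K)}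
    (hv : ((p : ℕ) : 𝓞 K) ∉ v.asIdeal) (hS : v ∈ S) :
    ρ.sigmaSelmerStructure p S L (Sum.inr v) =
      (⊤ : AddSubgroup (galoisCohomology (GaloisRep.toLocal v ρ) 1)) := by
  simp only [sigmaSelmerStructure, SelmerStructure.ofFinite_inr, dif_neg hv, if_pos hS]

/-- The `Σ`-structure at `v ∉ S`, `v ∤ p`, is the unramified subgroup. [folklore] -/
theorem sigmaSelmerStructure_inr_of_not_mem (ρ : DiscreteGaloisModule K W)
    (S : Set (HeightOneSpectrum (𝓞 K))) (L : ρ.LocalConditionsAbove p) {v : HeightOneSpectrum (𝓞 K)}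
    (hv : ((p : ℕ) : 𝓞 K) ∉ v.asIdeal) (hS : v ∉ S) :
    ρ.sigmaSelmerStructure p S L (Sum.inr v) = unramifiedSubgroup (GaloisRep.toLocal v ρ) 1 := by
  simp only [sigmaSelmerStructure, SelmerStructure.ofFinite_inr, dif_neg hv, if_neg hS]

/-- `Ш(K, W) ≤ H¹_Σ(K, W)`. [folklore] -/
theorem sha_le_sigmaSelmerGroup (ρ : DiscreteGaloisModule K W) (S : Set (HeightOneSpectrum (𝓞 K)))
    (L : ρ.LocalConditionsAbove p) : ρ.sha ≤ ρ.sigmaSelmerGroup p S L :=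
  ρ.sha_le_selmerGroup _

end DiscreteGaloisModule

namespace BlochKatoDatum

/-- The local datum at a finite place `v` (`K_v = v.adicCompletion K`, `GaloisRep.toLocal`). [folklore] -/
def toLocal (D : BlochKatoDatum K V W) (v : HeightOneSpectrum (𝓞 K)) :
    BlochKatoDatum (v.adicCompletion K) V W :=
  D.restrictField (v.adicCompletion K)

variable (p : ℕ)

/-- **Local conditions at the places above `p` for `V`**: a subgroup `L_v ⊆ H¹(K_v, V)` for each
`v ∣ p` — the slot of Bloch–Kato's `H¹_f(K_v, V) = ker (H¹(K_v, V) → H¹(K_v, B_crys ⊗ V))`, a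
parameter here (design notes). [cite: BlochKato1990, (3.7.2)] -/
abbrev LocalConditionsAbove (D : BlochKatoDatum K V W) : Type u :=
  ∀ v : HeightOneSpectrum (𝓞 K), ((p : ℕ) : 𝓞 K) ∈ v.asIdeal →
    AddSubgroup ((D.toLocal v).repV.cohomology 1)

/-- Transport of conditions on `V` above `p` to conditions on `W`: `L_v ↦ π_* L_v`
("`H¹_f(K_v, W) := im (H¹_f(K_v, V) → H¹(K_v, W))`"). [cite: DiamondFlachGuo2004, §2.1] -/
def LocalConditionsAbove.ofDatum {D : BlochKatoDatum K V W} (L : D.LocalConditionsAbove p) :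
    D.repW.LocalConditionsAbove p :=
  fun v hv => (D.toLocal v).imageSubgroup (L v hv)

end BlochKatoDatum

variable (p : ℕ)

/-- The **Bloch–Kato Selmer structure** of the datum `π : V → W`, relative to the conditions `L`
above `p`: at a finite place `v ∤ p` the finite subgroup `H¹_f(K_v, W) = π_* H¹_ur(K_v, V)`, at
`v ∣ p` the image `π_* L_v`, nothing at the infinite places (Bloch–Kato's Def. 5.1 with
`U = Spec O_K`).  [cite: BlochKato1990, Def. 5.1] -/
def blochKatoSelmerStructure (D : BlochKatoDatum K V W) (L : D.LocalConditionsAbove p) :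
    DiscreteGaloisModule.SelmerStructure D.repW :=
  DiscreteGaloisModule.SelmerStructure.ofFinite D.repW fun v =>
    haveI := Classical.propDecidable
    if hv : ((p : ℕ) : 𝓞 K) ∈ v.asIdeal then (D.toLocal v).imageSubgroup (L v hv)
    else (D.toLocal v).finiteSubgroup

/-- The **Bloch–Kato Selmer group `H¹_f(K, W) ⊆ H¹(K, W)`** of `W = V/T`: the classes whose
localisation lies in `H¹_f(K_v, W)` for every finite place `v` (`blochKatoSelmerStructure`), i.e.
`ker (H¹(K, W) → ⊕_v H¹(K_v, W)/H¹_f(K_v, W))`, relative to the conditions `L` above `p`.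
[cite: BlochKato1990, Def. 5.1] -/
def blochKatoSelmerGroup (D : BlochKatoDatum K V W) (L : D.LocalConditionsAbove p) :
    AddSubgroup (galoisCohomology D.repW 1) :=
  (blochKatoSelmerStructure p D L).selmerGroup

variable {p}

/-- The Bloch–Kato structure above `p` is `π_* L_v`. [folklore] -/
theorem blochKatoSelmerStructure_inr_of_mem (D : BlochKatoDatum K V W) (L : D.LocalConditionsAbove p)
    {v : HeightOneSpectrum (𝓞 K)} (hv : ((p : ℕ) : 𝓞 K) ∈ v.asIdeal) :
    blochKatoSelmerStructure p D L (Sum.inr v) = (D.toLocal v).imageSubgroup (L v hv) := by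
  simp only [blochKatoSelmerStructure, DiscreteGaloisModule.SelmerStructure.ofFinite_inr, dif_pos hv]

/-- The Bloch–Kato structure away from `p` is the finite subgroup `π_* H¹_ur(K_v, V)`. [folklore] -/
theorem blochKatoSelmerStructure_inr_of_not_mem (D : BlochKatoDatum K V W)
    (L : D.LocalConditionsAbove p) {v : HeightOneSpectrum (𝓞 K)} (hv : ((p : ℕ) : 𝓞 K) ∉ v.asIdeal) :
    blochKatoSelmerStructure p D L (Sum.inr v) = (D.toLocal v).finiteSubgroup := by
  simp only [blochKatoSelmerStructure, DiscreteGaloisModule.SelmerStructure.ofFinite_inr, dif_neg hv]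

/-- Membership in `H¹_f(K, W)`: local conditions at the finite places only.
[cite: BlochKato1990, Def. 5.1] -/
theorem mem_blochKatoSelmerGroup_iff (D : BlochKatoDatum K V W) (L : D.LocalConditionsAbove p)
    (c : galoisCohomology D.repW 1) :
    c ∈ blochKatoSelmerGroup p D L ↔ ∀ v : HeightOneSpectrum (𝓞 K),
      galoisCohomology.localization D.repW (Sum.inr v) 1 c ∈ blochKatoSelmerStructure p D L (Sum.inr v) :=
  DiscreteGaloisModule.SelmerStructure.mem_selmerGroup_ofFinite_iff _ _ c

/-- `Ш(K, W) ≤ H¹_f(K, W)`. [folklore] -/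
theorem sha_le_blochKatoSelmerGroup (D : BlochKatoDatum K V W) (L : D.LocalConditionsAbove p) :
    D.repW.sha ≤ blochKatoSelmerGroup p D L :=
  D.repW.sha_le_selmerGroup _

/-- **`H¹_f(K, W) ≤ H¹_Σ(K, W)`**: the Bloch–Kato Selmer group lies in the `Σ`-Selmer group with the
transported conditions `π_* L` above `p`, for every `S` (in particular in the group with minimal
conditions, `S = ∅`): the injection `H¹_f(ℚ, W) → H¹_Σ(ℚ, W)` of Diamond–Flach–Guo's Lemma 2.1.
[cite: DiamondFlachGuo2004, Lemma 2.1] -/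
theorem blochKatoSelmerGroup_le_sigmaSelmerGroup (D : BlochKatoDatum K V W)
    (L : D.LocalConditionsAbove p) (S : Set (HeightOneSpectrum (𝓞 K))) :
    blochKatoSelmerGroup p D L ≤
      D.repW.sigmaSelmerGroup p S (BlochKatoDatum.LocalConditionsAbove.ofDatum p L) := by
  intro c hc
  rw [mem_blochKatoSelmerGroup_iff] at hc
  refine (DiscreteGaloisModule.SelmerStructure.mem_selmerGroup_ofFinite_iff _ _ c).2 fun v => ?_
  by_cases hv : ((p : ℕ) : 𝓞 K) ∈ v.asIdeal
  · have h := hc v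
    rw [blochKatoSelmerStructure_inr_of_mem D L hv] at h
    simp only [dif_pos hv]
    exact h
  · have h := hc v
    rw [blochKatoSelmerStructure_inr_of_not_mem D L hv] at h
    by_cases hS : v ∈ S
    · simp only [dif_neg hv, if_pos hS]
      exact AddSubgroup.mem_top _
    · simp only [dif_neg hv, if_neg hS]
      exact (D.toLocal v).finiteSubgroup_le_unramifiedSubgroup h

end NumberField

end Literature.NumberTheory.GaloisRepresentations
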